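import Literature.AlgebraicGeometry.Frobenioids.ModelFrobenioidIsFrobenioid
import Literature.AlgebraicGeometry.Frobenioids.ElementaryFrobeniusCompact
import Literature.AnabelianGeometry.EtaleTheta.BiKummerThm44SubProofs
import Literature.AnabelianGeometry.EtaleTheta.Discharge.Sec4NonVacuity
import HarnessLib

/-!
# [EtTh] §4: the Theorem 4.4 discharge pipeline fires at the toy setting (consistency witness, part 2)

S. Mochizuki, *The étale theta function and its Frobenioid-theoretic manifestations*, Publ. RIMS **45**
(2009) [MochizukiEtTh2009], §4, Theorem 4.4 "Category-theoreticity of Bi-Kummer Data" (statement PDF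
pp. 93–94, proof pp. 94–95; printed 319–321), and [FrdI] Thm 5.2 (ii) ("the model Frobenioid is a
Frobenioid") as the standing hypothesis "`C_i` is a Frobenioid" of Thm 3.7 / Thm 4.4.

CONSISTENCY WITNESS, TOY — joint satisfiability of the §4 hypothesis packages; consistency ≠ faithfulness
(abc-iut-L2-lead 02:26:58Z).  Sequel of `Discharge/Sec4NonVacuity.lean` (the perfect toy tempered
Frobenioid `Toy.temperedFrobenioidQ` and the inhabited setting `Toy.biKummerSetting`, this seat).  Here:

* `Toy.temperedFrobenioidQ_isFrobenioid` — the toy IS a Frobenioid (REAL `PreFrobenioid.IsFrobenioid`), by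
  L1's [FrdI] Thm 5.2 (ii) `ModelFrobenioid.isFrobenioid` (`Φ = ℚ_{≥0}` a divisorial monoid on the
  one-object base, `B` a group-like monoid, base connected and totally epimorphic);
* `Toy.thm44HypId` — the IDENTITY self-equivalence `Ψ = Ψ^bs = 𝟭` inhabits abc-iut-L2-t3's hypothesis
  structure `BiKummerSetting.Thm44Hyp S S` (non-dilating = vocabulary slot; `D = D₀[∗]`; `H_⊙ = Π^tp_X`
  open), and satisfies every INPUT predicate of the printed proof as typed by abc-iut-w5-d179
  (`BiKummerThm44Sub.lean`): T44-L03 `PreservesFrobeniusStructure`, T44-L09 `HodotCompatible`, T44-L09c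
  `GaloisCompatible`, T44-L10 `BiratCompatible` (`ψ = id`), T44-L12 `PreservesDisjointSupports`, T44-L15b
  `PreservesNHSaturatedBsFld`, and the reflected Frobenius-type clause;
* hence the cell's closers `thm44_i_of_inputs`, `thm44_ii_of_subnodes`, `thm44_iii_of_inputs` FIRE:
  `Thm44_i h ∧ Thm44_ii h ψ ∧ Thm44_iii h ψ` for the explicit `h := thm44HypId`, `ψ := id`
  (`Toy.nonempty_thm44`) — their hypothesis lists are jointly satisfiable (the theorems are not vacuous)
  and the typed conclusions (i)–(iii) are consistent with the setting.

HONEST LIMITS as in part 1: one-object base, trivial [FrdI] vocabularies, `(N,H)`-slot `True`, not a curve;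
(iv) is not exercised here (its closers live over `treeCatVocab`).  Definitions = toy DATA (`thm44HypId`);
no `Prop`-valued definition, no named fact, no instance, no `sorry`.  Nothing here bears on, or takes a
side on, [IUTchIII] Cor. 3.12.
-/

noncomputable section

namespace Literature.AnabelianGeometry.EtaleTheta

open CategoryTheory Opposite Literature.AlgebraicGeometry.Frobenioids
open scoped NNRat

namespace Toy

/-- Automorphism groups in the one-object discrete base category are trivial. [folklore] -/
private theorem subsingleton_aut' (A : Discrete PUnit.{1}) : Subsingleton (Aut A) :=
  ⟨fun _ _ => Iso.ext (Subsingleton.elim _ _)⟩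

/-! ## [FrdI] Thm 5.2 (ii) and [EtTh] Thm 4.4 (i)(ii)(iii) at the toy: the Thm 4.4 discharge pipeline's
hypothesis lists are jointly satisfiable (identity self-equivalence of the toy setting)

Over `S := Toy.biKummerSetting`: the toy tempered Frobenioid IS a Frobenioid (REAL
`PreFrobenioid.IsFrobenioid`, L1's [FrdI] Thm 5.2 (ii) `ModelFrobenioid.isFrobenioid`: `Φ = ℚ_{≥0}`
divisorial and a monoid on the one-object base, `B` group-like, base connected and totally epimorphic),
and the IDENTITY self-equivalence `Ψ = Ψ^bs = 𝟭` inhabits abc-iut-L2-t3's `Thm44Hyp S S` (non-dilating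
= vocabulary slot, `D = D₀[𝒟]` shape, `H_⊙ = Π^tp_X` open) together with every INPUT predicate of the
printed proof of Thm 4.4 (T44-L03 `PreservesFrobeniusStructure`, T44-L09 `HodotCompatible`, T44-L09c
`GaloisCompatible`, T44-L10 `BiratCompatible` for `ψ = id`, T44-L12 `PreservesDisjointSupports`, T44-L15b
`PreservesNHSaturatedBsFld`, the reflected Frobenius-type clause), so that the cell's closers
`thm44_i_of_inputs` (abc-iut-w5-d179), `thm44_ii_of_subnodes`, `thm44_iii_of_inputs` FIRE and yield
`Thm44_i h ∧ Thm44_ii h ψ ∧ Thm44_iii h ψ` for an explicit `h` — their hypothesis lists are jointly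
satisfiable and the typed conclusions are consistent. -/

/-- In the one-object discrete base every pull-back map of a functor `Φ : D₀ᵒᵖ → 𝔐𝔬𝔫` is bijective (the
only arrow is the identity). [folklore] -/
private theorem pull_bijective_discretePUnit (Φ : (Discrete PUnit.{1})ᵒᵖ ⥤ CommMonCat.{0})
    {A B : Discrete PUnit.{1}} (f : B ⟶ A) : Function.Bijective (pull Φ f) := by
  obtain ⟨⟨⟩⟩ := A
  obtain ⟨⟨⟩⟩ := B
  obtain rfl : f = 𝟙 _ := Subsingleton.elim _ _
  have h : pull Φ (𝟙 (⟨PUnit.unit⟩ : Discrete PUnit.{1})) = MonoidHom.id _ := by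
    ext x
    change (Φ.map (𝟙 _).op).hom x = x
    rw [op_id, Φ.map_id]
    rfl
  rw [h]
  exact Function.bijective_id

/-- `Φ = ℚ_{≥0}` of the perfect toy is a monoid on the base ([FrdI] Def 1.1 (ii): all pull-backs bijective).
[cite: MochizukiEtTh2009, Def 3.6 p.77] -/
theorem divisorMonoidQ_isMonoidOn : IsMonoidOn temperedFrobenioidQ.divisorMonoid :=
  isMonoidOn_of_bijective fun f => pull_bijective_discretePUnit _ f

/-- `B` of the perfect toy is a monoid on the base. [cite: MochizukiEtTh2009, Def 3.6 p.77] -/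
theorem ratFnFunctorQ_isMonoidOn : IsMonoidOn temperedFrobenioidQ.ratFnFunctor :=
  isMonoidOn_of_bijective fun f => pull_bijective_discretePUnit _ f

/-- **The perfect toy tempered Frobenioid is a Frobenioid** (REAL `PreFrobenioid.IsFrobenioid`, by L1's
[FrdI] Thm 5.2 (ii) `ModelFrobenioid.isFrobenioid`: `Φ` a divisorial monoid, `B` a group-like monoid on the
connected, totally epimorphic one-object base) — the standing hypothesis "`C` is a Frobenioid" (Thm 3.7,
SUBDAG-Thm44 (α)) is satisfiable jointly with the §4 setting. [cite: MochizukiEtTh2009, Thm 3.7 p.79] -/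
theorem temperedFrobenioidQ_isFrobenioid : PreFrobenioid.IsFrobenioid temperedFrobenioidQ.toElem :=
  ModelFrobenioid.isFrobenioid divisorMonoidQ_isMonoidOn divisorMonoidQ_isDivisorial ratFnFunctorQ_isMonoidOn
    ratFnFunctorQ_isGroupLike (isGraphConnected_iff_isConnected.2 temperedFrobenioidQ.isConnected)
    temperedFrobenioidQ.isTotallyEpimorphic

/-- `H_⊙ = Π^tp_X` for the toy setting (the Galois surjection is trivial). [cite: MochizukiEtTh2009, Def 4.1 p.86] -/
theorem hodot_eq_top : biKummerSetting.Hodot = ⊤ :=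
  MonoidHom.ker_one

/-- **`Thm44Hyp` inhabited**: the identity self-equivalence of the toy §4 setting (`Ψ = 𝟭`, `Ψ^bs = 𝟭`,
`Base ∘ 𝟭 ≅ 𝟭 ∘ Base` by unitors): `Φ` non-dilating (vocabulary slot), `D = D₀[∗]` (`Base = 𝟭` is fully
faithful and every object maps to `∗`), `H_⊙ = Π^tp_X` open, `Ψ^bs(A_⊙^bs) ≅ A_⊙^bs`.
[cite: MochizukiEtTh2009, Thm 4.4 p.93] -/
def thm44HypId : BiKummerSetting.Thm44Hyp biKummerSetting biKummerSetting where
  isNonDilating₁ _ _ := trivial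
  isNonDilating₂ _ _ := trivial
  baseShape₁ := ⟨(inferInstance : (𝟭 (Discrete PUnit.{1})).Full),
    (inferInstance : (𝟭 (Discrete PUnit.{1})).Faithful),
    ⟨PUnit.unit⟩, fun Y => ⟨fun _ => ⟨⟨⟨Subsingleton.elim _ _⟩⟩⟩, fun _ => ⟨Y, ⟨Iso.refl _⟩⟩⟩⟩
  baseShape₂ := ⟨(inferInstance : (𝟭 (Discrete PUnit.{1})).Full),
    (inferInstance : (𝟭 (Discrete PUnit.{1})).Faithful),
    ⟨PUnit.unit⟩, fun Y => ⟨fun _ => ⟨⟨⟨Subsingleton.elim _ _⟩⟩⟩, fun _ => ⟨Y, ⟨Iso.refl _⟩⟩⟩⟩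
  isOpen_Hodot₁ := by rw [hodot_eq_top, Subgroup.coe_top]; exact isOpen_univ
  isOpen_Hodot₂ := by rw [hodot_eq_top, Subgroup.coe_top]; exact isOpen_univ
  Ψ := CategoryTheory.Equivalence.refl
  Ψbs := CategoryTheory.Equivalence.refl
  comm := biKummerSetting.base.rightUnitor ≪≫ biKummerSetting.base.leftUnitor.symm
  mapsAodot := ⟨Iso.refl _⟩

/-- T44-L03 at the identity: Frobenius degrees, isometries, Frobenius-type and pull-back morphisms are
preserved. [cite: MochizukiEtTh2009, Thm 4.4 p.95] -/
theorem thm44HypId_preservesFrobeniusStructure : thm44HypId.PreservesFrobeniusStructure :=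
  ⟨fun _ _ _ => rfl, fun _ _ _ h => h, fun _ _ _ h => h, fun _ _ _ h => h⟩

/-- T44-L09 at the identity: `θ = id` carries `H_⊙` onto itself. [cite: MochizukiEtTh2009, Thm 4.4 p.94] -/
theorem thm44HypId_hodotCompatible : thm44HypId.HodotCompatible :=
  ⟨ContinuousMulEquiv.refl _, Subgroup.map_id _⟩

/-- T44-L09c at the identity: `Aut_D(A^bs)` is trivial, so `H_A^bs` is carried onto `H_{Ψ A}^bs`.
[cite: MochizukiEtTh2009, Thm 4.4 p.94] -/
theorem thm44HypId_galoisCompatible : thm44HypId.GaloisCompatible := fun A _ =>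
  ⟨trivial, Subgroup.ext fun σ => by
    haveI := subsingleton_aut' (biKummerSetting.base.obj (thm44HypId.Ψ.functor.obj A))
    rw [Subsingleton.elim σ 1]
    exact ⟨fun _ => one_mem _, fun _ => one_mem _⟩⟩

/-- T44-L10 at the identity with `ψ = id`: restriction, fractions and `Aut`-actions are compatible.
[cite: MochizukiEtTh2009, Thm 4.4 p.95] -/
theorem thm44HypId_biratCompatible : thm44HypId.BiratCompatible fun _ => MulEquiv.refl _ where
  restrict _ _ _ _ := rfl
  frac _ _ _ _ _ _ _ _ := rfl
  aut _ _ := rfl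

/-- T44-L12 at the identity: disjointness of supports is preserved. [cite: MochizukiEtTh2009, Thm 4.4 p.95] -/
theorem thm44HypId_preservesDisjointSupports : thm44HypId.PreservesDisjointSupports :=
  fun _ _ _ _ h => h

/-- T44-L15b at the identity: the `(N, H^{bs-fld})`-saturation slot of the toy is constant.
[cite: MochizukiEtTh2009, Thm 4.4 p.95] -/
theorem thm44HypId_preservesNHSaturatedBsFld : thm44HypId.PreservesNHSaturatedBsFld :=
  fun _ _ _ _ _ => Iff.rfl

/-- **Thm 4.4 (i) FIRES at the toy** through abc-iut-w5-d179's closer `thm44_i_of_inputs` ("`C₂` is a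
Frobenioid" REAL, T44-L03, T44-L09c, T44-L09): its hypothesis list is jointly satisfiable.
[cite: MochizukiEtTh2009, Thm 4.4 p.94] -/
theorem thm44_i_id : BiKummerSetting.Thm44_i thm44HypId :=
  thm44HypId.thm44_i_of_inputs temperedFrobenioidQ_isFrobenioid thm44HypId_preservesFrobeniusStructure
    thm44HypId_galoisCompatible thm44HypId_hodotCompatible

/-- **Thm 4.4 (ii) FIRES at the toy** through `thm44_ii_of_subnodes` (T44-L03, T44-L10, T44-L12) with
`ψ = id`. [cite: MochizukiEtTh2009, Thm 4.4 p.94] -/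
theorem thm44_ii_id : BiKummerSetting.Thm44_ii thm44HypId fun _ => MulEquiv.refl _ :=
  thm44HypId.thm44_ii_of_subnodes _ thm44HypId_preservesFrobeniusStructure thm44HypId_biratCompatible
    thm44HypId_preservesDisjointSupports

/-- **Thm 4.4 (iii) FIRES at the toy** through `thm44_iii_of_inputs` (T44-L03, reflected Frobenius type,
"`C₂` is a Frobenioid" REAL, T44-L15b) with `ψ = id`. [cite: MochizukiEtTh2009, Thm 4.4 p.94] -/
theorem thm44_iii_id : BiKummerSetting.Thm44_iii thm44HypId fun _ => MulEquiv.refl _ :=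
  thm44HypId.thm44_iii_of_inputs _ thm44HypId_preservesFrobeniusStructure (fun _ _ _ h => h)
    temperedFrobenioidQ_isFrobenioid thm44HypId_preservesNHSaturatedBsFld

/-- **Consistency witness for the Thm 4.4 discharge pipeline**: there is an inhabitant `h` of `Thm44Hyp`
(over an inhabited `BiKummerSetting`, both sides the perfect toy) and a `ψ` for which the typed
conclusions `Thm44_i h`, `Thm44_ii h ψ`, `Thm44_iii h ψ` all hold — obtained by running the cell's own
closers on satisfiable inputs. [cite: MochizukiEtTh2009, Thm 4.4 p.94] -/
theorem nonempty_thm44 :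
    ∃ (h : BiKummerSetting.Thm44Hyp biKummerSetting biKummerSetting)
      (ψ : ∀ A : biKummerSetting.C, biKummerSetting.biratUnits A ≃* biKummerSetting.biratUnits (h.Ψ.functor.obj A)),
      BiKummerSetting.Thm44_i h ∧ BiKummerSetting.Thm44_ii h ψ ∧ BiKummerSetting.Thm44_iii h ψ :=
  ⟨thm44HypId, fun _ => MulEquiv.refl _, thm44_i_id, thm44_ii_id, thm44_iii_id⟩

end Toy

end Literature.AnabelianGeometry.EtaleTheta

end
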